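import Summits.Parity.GeneralizedHardyLittlewood.Theses.PrimeLevelFamEdge
import HarnessLib

/-!
# `BeyondDiagonalBeatsQuarter` (stmt-Parity-20055): the moment-asymptotics hypothesis is load-bearing

Route `PrimeLevelFamEdge` (cell landau-siegel §D, BIRTH (2)), crux K_B rev 2
`BeyondDiagonalBeatsQuarter := ∀ Δ > 1, ∀ T₁ T₂, MomentAsymptotics 1 Δ T₁ T₂ → ∃ (a,b) ⊂ [1,Δ], a < 3/2,
∃ P admissible, ∀ Δ' ∈ (a,b), ¼ < (linForm Δ' P 1 + T₁ Δ' P 1)² / (2(secondMomentForm Δ' P 1 + T₂ Δ' P 1))`.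
Refuter's hypothesis-mutation record (ONE PASS step 5): with the hypothesis
`KMV2000.MomentAsymptotics 1 Δ T₁ T₂` DROPPED the statement is FALSE — the functional
`T₂(Δ',P,Q) := linForm² − offDiagForm + 1` (so that `secondMomentForm + T₂ = 2·linForm² + 1`) keeps the
Cauchy–Schwarz value `linForm²/(4·linForm² + 2)` below `¼` for EVERY profile on EVERY window. So any
proof of K_B must use the moment asymptotics (the pinning of `T₁, T₂` to the true off-diagonal main
terms); nothing in the shape of the value functional alone beats `¼`. Standard axioms, no `sorry`.
«The programme SEARCHES and TYPES; no claim about Landau–Siegel zeros, Theorems 1–2 of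
arXiv:2211.02515 or a repaired Margin232 until a kernel theorem says so.»

## References

* [KowalskiMichelVanderKam2000] E. Kowalski, P. Michel, J. VanderKam, J. reine angew. Math. 526
  (2000) 1–34: Thm. 6.1 (30)–(32) (the forms `linForm`, `secondMomentForm = linForm² + offDiagForm`).
  [held: paper:doi-10-1515-crll-2000-074]
-/

namespace Summit.Parity.GeneralizedHardyLittlewood.Theorems.BeyondDiagonalBeatsQuarter.Negative

open Polynomial
open Literature.NumberTheory.LFunctions

/-- **K_B without the moment-asymptotics hypothesis is false** (witness `Δ = 2`, `T₁ = 0`,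
`T₂ = linForm² − offDiagForm + 1`, evaluated at the midpoint of any proposed window).
[cite: KowalskiMichelVanderKam2000, Thm. 6.1 (30)–(32)] -/
theorem beyondDiagonalBeatsQuarter_false_without_momentAsymptotics :
    ¬ (∀ Δ : ℝ, 1 < Δ → ∀ T₁ T₂ : ℝ → ℝ[X] → ℝ[X] → ℝ,
        ∃ a b : ℝ, 1 ≤ a ∧ a < b ∧ b ≤ Δ ∧ a < 3 / 2 ∧ ∃ P : ℝ[X], KMV2000.Admissible P ∧
          ∀ Δ' : ℝ, a < Δ' → Δ' < b →
            1 / 4 < (KMV2000.linForm Δ' P 1 + T₁ Δ' P 1) ^ 2 /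
              (2 * (KMV2000.secondMomentForm Δ' P 1 + T₂ Δ' P 1))) := by
  intro h
  obtain ⟨a, b, -, hab, -, -, P, -, hval⟩ := h 2 (by norm_num) (fun _ _ _ => 0)
    (fun Δ' P Q => KMV2000.linForm Δ' P Q ^ 2 - KMV2000.offDiagForm Δ' P Q + 1)
  have h1 := hval ((a + b) / 2) (by linarith) (by linarith)
  simp only [KMV2000.secondMomentForm, add_zero] at h1
  set L := KMV2000.linForm ((a + b) / 2) P 1 with hL
  set O := KMV2000.offDiagForm ((a + b) / 2) P 1 with hO
  have hden : 2 * (L ^ 2 + O + (L ^ 2 - O + 1)) = 4 * L ^ 2 + 2 := by ring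
  rw [hden] at h1
  have hpos : 0 < 4 * L ^ 2 + 2 := by positivity
  rw [lt_div_iff₀ hpos] at h1
  nlinarith [sq_nonneg L]

end Summit.Parity.GeneralizedHardyLittlewood.Theorems.BeyondDiagonalBeatsQuarter.Negative
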